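import Literature.Computability.QuantumComplexity.Lemma24Block
import HarnessLib

/-!
# Aaronson–Ambainis Lemma 24 over the sign basis, X: the instance — 24 blocks side by side

Tenth file of the discharge of `AaronsonAmbainis2018_lemma24_sign_hard` (plan in
`Lemma24Catalysis.lean`). One block of the reduction (`Lemma24Block.lean`) has transition amplitude
`A ≥ (997/1000)(80/81)` when the simulated Clifford+`T` circuit `C` accepts `x` with probability
`≥ 2/3`, and `0 ≤ A ≤ 65/81 + 3/1000` when it accepts with probability `≤ 1/3`. QSIM over the sign
basis (`qSimSignProblem`, `QSimSign.lean`) asks for `A_Q ≥ 3/5` against `|A_Q| ≤ 1/100`; the gap is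
reached by running `24` copies of the block on pairwise disjoint ranges of wires of one register
(block `j` on the wires `j·B, …, j·B + B − 1`, `B = 4(n+m) + 7` the width of a block): the all-zero
state is the product of the all-zero states of the ranges, independent circuits act factorwise
(the frame rule `toMatrix_flatMap_mapWires_mulVec_prodState` of `CircuitEmbedding.lean`,
Nielsen–Chuang 2010, §2.1.7, eq. (2.45)), so the amplitude of the instance is `A^24`
(`signAmplitude_lemma24Circuit`), and `((997/1000)(80/81))^24 ≥ 3/5`,
`(65/81 + 3/1000)^24 ≤ 1/100` (`isYes_lemma24Instance`, `isNo_lemma24Instance`). This is the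
"tensor power" form of the amplification step of the printed proof (p. 26), applied after the
in-block OR of four runs (`Lemma24Copies.lean`).

* `blkEmb B j` — the range of block `j < 24` in `Fin (24·B)`; `blkEmb_blockDisjoint`;
* `lemma24Circuit C x`, `lemma24Instance C x` — the sign-basis circuit / QSIM instance of the reduction;
* `signAmplitude_lemma24Circuit : A(instance) = A(block)^24`;
* `isYes_lemma24Instance`, `isNo_lemma24Instance` — the two sides of the promise.

## References

* S. Aaronson, A. Ambainis, *Forrelation: a problem that optimally separates quantum from classical
  computing*, SIAM J. Comput. 47 (2018) 982–1038; arXiv:1411.5729, §6, Lemma 24 (p. 26).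
* M. A. Nielsen, I. L. Chuang, *Quantum Computation and Quantum Information*, CUP 2010, §2.1.7
  (eq. (2.45)), §2.2.8, §4.5.2 (repetition).
-/

noncomputable section

namespace Literature.Computability.QuantumComplexity

open Matrix _root_.Computability Complexity Cryptography Finset

namespace Lemma24

/-! ### The ranges of the blocks -/

/-- Block `j < 24` of width `B` occupies the wires `j·B + i`, `i < B`, of `Fin (24·B)`. [cite: NielsenChuang2010, §2.1.7] -/
def blkEmb (B : ℕ) (j : Fin 24) : Fin B ↪ Fin (24 * B) :=
  ⟨fun i => ⟨(j : ℕ) * B + i, by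
      have hj : (j : ℕ) + 1 ≤ 24 := j.isLt
      have hi := i.isLt
      calc (j : ℕ) * B + i < (j : ℕ) * B + B := by omega
        _ = ((j : ℕ) + 1) * B := by ring
        _ ≤ 24 * B := Nat.mul_le_mul_right _ hj⟩,
    fun i i' h => by
      have := congrArg Fin.val h
      exact Fin.ext (by simpa using this)⟩

/-- The value of `blkEmb`. [folklore] -/
@[simp] theorem blkEmb_val (B : ℕ) (j : Fin 24) (i : Fin B) : (blkEmb B j i : ℕ) = (j : ℕ) * B + i := rfl

/-- **The ranges of distinct blocks are disjoint.** [cite: NielsenChuang2010, §2.1.7] -/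
theorem blkEmb_blockDisjoint (B : ℕ) : BlockDisjoint (blkEmb B) := by
  intro j j' hjj'
  refine Set.disjoint_left.2 ?_
  rintro w ⟨i, rfl⟩ ⟨i', hi'⟩
  have hv := congrArg Fin.val hi'
  simp only [blkEmb_val] at hv
  have hi := i.isLt
  have hi'' := i'.isLt
  rcases lt_or_gt_of_ne (Fin.val_ne_of_ne hjj') with h | h
  · -- `j < j'`: the wire of block `j` is below every wire of block `j'`
    have h1 : (j : ℕ) + 1 ≤ (j' : ℕ) := h
    have h2 : ((j : ℕ) + 1) * B ≤ (j' : ℕ) * B := Nat.mul_le_mul_right _ h1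
    have h3 : (j : ℕ) * B + i < ((j : ℕ) + 1) * B := by nlinarith
    omega
  · have h1 : (j' : ℕ) + 1 ≤ (j : ℕ) := h
    have h2 : ((j' : ℕ) + 1) * B ≤ (j : ℕ) * B := Nat.mul_le_mul_right _ h1
    have h3 : (j' : ℕ) * B + i' < ((j' : ℕ) + 1) * B := by nlinarith
    omega

/-! ### The instance -/

variable {n m : ℕ}

/-- **The sign-basis circuit of the reduction**: the `24` blocks `blockCircuit C x` placed on the
ranges `blkEmb _ j`, `j = 0, …, 23`, in this order. [cite: AaronsonAmbainis2018, §6 Lemma 24 (p. 26)] -/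
def lemma24Circuit (C : QCircuit cliffordT (n + m)) (x : QReg n) : QCircuit hSign (24 * (Kw (n + m) + 2 + 1)) :=
  ⟨(List.finRange 24).flatMap fun j => (mapWires (blkEmb (Kw (n + m) + 2 + 1) j) (blockCircuit C x)).gates⟩

/-- **The QSIM instance of the reduction** (`24(4(n+m)+7)` qubits). [cite: AaronsonAmbainis2018, §6 Lemma 24 (p. 26)] -/
def lemma24Instance (C : QCircuit cliffordT (n + m)) (x : QReg n) : QSimSignInstance :=
  ⟨24 * (Kw (n + m) + 2 + 1), lemma24Circuit C x⟩

/-- The gates of the instance. [folklore] -/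
theorem gates_lemma24Circuit (C : QCircuit cliffordT (n + m)) (x : QReg n) :
    (lemma24Circuit C x).gates =
      (List.finRange 24).flatMap fun j => (blockCircuit C x).gates.map (mapWiresGate (blkEmb (Kw (n + m) + 2 + 1) j)) := rfl

/-- The instance is oracle-free. [folklore] -/
theorem lemma24Circuit_isOracleFree (C : QCircuit cliffordT (n + m)) (x : QReg n) : (lemma24Circuit C x).IsOracleFree := by
  intro g hg
  rw [gates_lemma24Circuit, List.mem_flatMap] at hg
  obtain ⟨j, -, hj⟩ := hg
  exact isOracleFree_mapWires _ (blockCircuit_isOracleFree C x) g hj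

/-- **The amplitude of the instance is the `24`-th power of the amplitude of a block**: `|0…0⟩` is
the product of the all-zero states of the ranges and the blocks act factorwise.
[cite: NielsenChuang2010, §2.1.7 eq. (2.45)] -/
theorem signAmplitude_lemma24Circuit (C : QCircuit cliffordT (n + m)) (x : QReg n) :
    signAmplitude (lemma24Circuit C x) = signAmplitude (blockCircuit C x) ^ 24 := by
  set B := Kw (n + m) + 2 + 1 with hB
  have hz : ∀ j : Fin 24, ((fun _ : Fin (24 * B) => false) ∘ blkEmb B j) = fun _ : Fin B => false := fun j => rfl
  -- the complex entry `⟨0|U|0⟩` as a product over the blocks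
  have hentry : (lemma24Circuit C x).mat (fun _ => false) (fun _ => false) =
      ∏ _j : Fin 24, (blockCircuit C x).mat (fun _ => false) (fun _ => false) := by
    have h1 : (lemma24Circuit C x).mat (fun _ => false) (fun _ => false) =
        ((lemma24Circuit C x).toMatrix 0 *ᵥ basisState (fun _ => false)) (fun _ => false) := by
      rw [mulVec_basisState]
    rw [h1, basisState_eq_prodState (blkEmb B), lemma24Circuit,
      toMatrix_flatMap_mapWires_mulVec_prodState 0 (blkEmb_blockDisjoint B) (fun _ => blockCircuit C x),
      prodState_apply, if_pos (fun w _ => rfl), one_mul]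
    refine Finset.prod_congr rfl fun j _ => ?_
    rw [hz j, mulVec_basisState]
  have hc : ((signAmplitude (lemma24Circuit C x) : ℝ) : ℂ) = ((signAmplitude (blockCircuit C x) ^ 24 : ℝ) : ℂ) := by
    rw [signAmplitude_coe, hentry, Complex.ofReal_pow, signAmplitude_coe, Finset.prod_const, Finset.card_univ,
      Fintype.card_fin]
  exact_mod_cast hc

/-- The amplitude of the instance, as an instance. [folklore] -/
theorem amplitude_lemma24Instance (C : QCircuit cliffordT (n + m)) (x : QReg n) :
    (lemma24Instance C x).amplitude = signAmplitude (blockCircuit C x) ^ 24 :=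
  signAmplitude_lemma24Circuit C x

/-- The yes-side numerics: `((997/1000)(80/81))^24 ≥ 3/5`. [folklore] -/
theorem yes_threshold : (3 : ℝ) / 5 ≤ ((997 : ℝ) / 1000 * (80 / 81)) ^ 24 := by norm_num

/-- The no-side numerics: `(65/81 + 3/1000)^24 ≤ 1/100`. [folklore] -/
theorem no_threshold : ((65 : ℝ) / 81 + 3 / 1000) ^ 24 ≤ 1 / 100 := by norm_num

/-- **Yes side**: if `C` (oracle-free) accepts `x` with probability `≥ 2/3` (and `≤ 1`), the
instance is a yes-instance of QSIM over the sign basis (`A ≥ 3/5`). [cite: AaronsonAmbainis2018, §6 Lemma 24 (p. 26)] -/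
theorem isYes_lemma24Instance {C : QCircuit cliffordT (n + m)} (hC : C.IsOracleFree) {x : QReg n}
    (hp : 2 / 3 ≤ C.acceptProb 0 x) (hp1 : C.acceptProb 0 x ≤ 1) : (lemma24Instance C x).IsYes := by
  refine ⟨lemma24Circuit_isOracleFree C x, ?_⟩
  rw [amplitude_lemma24Instance]
  have h := signAmplitude_blockCircuit_ge hC hp hp1
  have h0 : (0 : ℝ) ≤ 997 / 1000 * (80 / 81) := by norm_num
  exact yes_threshold.trans (pow_le_pow_left₀ h0 h 24)

/-- **No side**: if `C` (oracle-free) accepts `x` with probability `≤ 1/3` (and `≥ 0`), the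
instance is a no-instance (`|A| ≤ 1/100`). [cite: AaronsonAmbainis2018, §6 Lemma 24 (p. 26)] -/
theorem isNo_lemma24Instance {C : QCircuit cliffordT (n + m)} (hC : C.IsOracleFree) {x : QReg n}
    (hp : C.acceptProb 0 x ≤ 1 / 3) (hp0 : 0 ≤ C.acceptProb 0 x) (hp1 : C.acceptProb 0 x ≤ 1) :
    (lemma24Instance C x).IsNo := by
  refine ⟨lemma24Circuit_isOracleFree C x, ?_⟩
  rw [amplitude_lemma24Instance]
  have h := signAmplitude_blockCircuit_le hC hp hp0
  have h0 := signAmplitude_blockCircuit_nonneg hC hp0 hp1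
  rw [abs_of_nonneg (pow_nonneg h0 24)]
  exact (pow_le_pow_left₀ h0 h 24).trans no_threshold

end Lemma24

end Literature.Computability.QuantumComplexity

end
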